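import Literature.Analysis.FluidPDE.NSCriticalClosureBesovBounded
import Literature.Analysis.FluidPDE.NSBoundedMildOseenAssembly
import Literature.Analysis.FluidPDE.LerayHopfRestart
import HarnessLib

/-!
# GKP (1.6) for the tree's Besov mild class: reduction to the KNSS bounded step, given restart

Analysis/FluidPDE assembly file (proofs only, no definitions, no named facts) for the named fact
`Literature.Analysis.FluidPDE.gkp_smooth_of_isBesovMildSolutionOn` (`NSCriticalClosureBesov.lean`;
Gallagher–Koch–Planchon 2016, (1.6): a Besov mild solution `(u, U)` on `[0, T)` in the class
`IsBesovMildSolutionOn (-1 + 3/p) p q T ν` of `CriticalRegularity.lean` agrees at every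
`t ∈ (0, T)`, a.e., with a classical solution of the unforced system on `(0, T)`).

## What the printed source says, and what the tree's statement adds

GKP 2016, (1.6) (arXiv:1407.4156, p. 4) is printed for solutions of the Duhamel equation (1.2)
in the Chemin–Lerner class `𝓛^{1:∞}_{p,q}(T) = ⋂_{1 ≤ r ≤ ∞} L̃^r([0,T]; Ḃ^{s_p + 2/r}_{p,q})`
(Def. 1.2, (1.5)), where the bilinear Duhamel term converges absolutely; Lemarié-Rieusset 2016,
Thm. 9.12 (the class-level statement cited by the fact) is printed for *bounded* solutions of
the Oseen integral equation on `(T₀, T₁) × ℝ³`. The tree's class `IsBesovMildSolutionOn`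
(duality-form mild identity **from `t = 0`**, `Fluid.IsMildNSSolutionOn (Ico 0 T) ν 0 (u 0) u`,
with Mathlib Bochner integrals; Kato's weight `sup_{0<τ<t} √τ ‖u(τ)‖_∞ < ∞`; `U ∈ C([0,T); Ḃ)`)
is neither: on it the nonlinear integrand `τ ↦ ∫⟪u τ, (u τ · ∇) e^{ν(t-τ)Δ}φ⟫` of the duality
identity is a priori only `O(τ⁻¹)` at `τ → 0⁺` (`K_∞` and `C_t Ḃ^{s_p}_{p,q}`, `s_p < 0`, give no
better), so the time integral may be Mathlib's junk value `0`, and no printed argument controls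
this regime (this is the diagnosis already recorded in `NSCriticalClosureBesovBounded.lean`, which
re-routed the continuation criterion through the bounded form
`knss_classical_of_bounded_isBesovMildSolutionOn`, itself reduced in
`NSBoundedMildOseenAssembly.lean` to the single local fact (L) `knss2009_local_smoothing ℝ³`).

## What this file proves

The gap between the tree's class and the printed classes is *exactly* the **restart of the
duality identity at positive times**: the two-time identity
`Fluid.IsMildNSSolutionBetween ν 0 u s t` for `0 < s < t < T` (Fabes–Jones–Rivière 1972,
Thm. 2.1; in the printed classes it follows from the semigroup property of the absolutely
convergent Duhamel formula, KNSS 2009 §4 "as an ODE in `t`", Lemarié-Rieusset 2016 (9.38)).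
Granted the restart identities for a member `(u, U)` of the class:

* `IsBesovMildSolutionOn.translate`: the time translate `(u(· + s), U(· + s))`, `0 < s < T`, is a
  Besov mild solution on `[0, T - s)` from the datum `u(s)` (the class is closed under
  translation: measurability `aestronglyMeasurable_uncurry_translate`, Besov continuity
  `ContinuousInHomBesovOn.translate`, Kato's class `MemKatoClassOn.translate`), whose slices are
  uniformly essentially bounded down to its initial time by Kato's weight,
  `‖u(τ)‖_∞ ≤ K/√s` for `τ ≥ s` (`MemKatoClassOn.exists_eLpNorm_translate_le`);
* `IsBesovMildSolutionOn.exists_classical_of_restart`: hence, **given**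
  `knss_classical_of_bounded_isBesovMildSolutionOn`, each translate agrees a.e. with a classical
  solution on `(0, T - s)`; translated back (`IsClassicalNSSolutionOn.comp_add_right`) these are
  classical solutions on `(s, T)` whose (continuous) velocities agree wherever both are defined,
  and the family glues to one classical solution on `(0, T)`
  (`IsClassicalNSSolutionOn.glue_Ioo_family`: velocity `t ↦ w_{t/2}(t)`, pressures normalised
  by their value at the origin as in `IsClassicalNSSolutionOn.glue`);
* `gkp_smooth_of_isBesovMildSolutionOn_of_knss_of_restart`,
  `gkp_smooth_of_isBesovMildSolutionOn_of_local_of_restart`: the named fact follows from the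
  KNSS bounded smoothing fact — equivalently, after `NSBoundedMildOseenAssembly.lean`, from
  (L) `knss2009_local_smoothing ℝ³` — **and** the restart property of the class, the latter kept
  as an explicit hypothesis (it is not a published result about this class and is not asserted).

Nothing is asserted beyond these implications; no statement of the tree is changed.

## References

* I. Gallagher, G. S. Koch, F. Planchon, *Blow-up of critical Besov norms at a potential
  Navier–Stokes singularity*, Comm. Math. Phys. 343 (2016) 39–82 = arXiv:1407.4156: Def. 1.2,
  (1.2), (1.5), (1.6) (p. 4). [GKP2016]
* G. Koch, N. Nadirashvili, G. Seregin, V. Šverák, *Liouville theorems for the Navier–Stokes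
  equations and applications*, Acta Math. 203 (2009) 83–105 = arXiv:0709.3599, §4 p. 8.
  [KochNadirashviliSereginSverak2009]
* P. G. Lemarié-Rieusset, *The Navier–Stokes problem in the 21st century* (CRC 2016), Thm. 9.12,
  (9.38). [LemarieRieusset2016]
* E. B. Fabes, B. F. Jones, N. M. Rivière, Arch. Rational Mech. Anal. 45 (1972), Thm. 2.1 (the
  two-time duality identity). [FabesJonesRiviere1972]
-/

noncomputable section

open MeasureTheory TemperedDistribution Set Function Filter
open _root_.Topology
open scoped SchwartzMap ENNReal NNReal RealInnerProductSpace

namespace Literature.Analysis.FluidPDE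

/-! ## Time translation of the duality identity and of the Besov mild class -/

section Translate

variable {E : Type*} [NormedAddCommGroup E] [InnerProductSpace ℝ E] [FiniteDimensional ℝ E]
  [MeasurableSpace E] [BorelSpace E]

/-- **The two-time identity is the identity from the datum `u(s)` for the translate.** If the
duality identity holds between the times `s` and `t + s` (force `0`), then the translate
`u(· + s)` satisfies the duality identity from the datum `u(s)` at time `t` (change of variables
`τ ↦ τ + s` in the time integral; Fabes–Jones–Rivière 1972, Thm. 2.1). [cite: FabesJonesRiviere1972, Thm. 2.1] -/
theorem IsMildNSSolutionBetween.isMildNSSolutionFrom_translate {ν s t : ℝ} {u : ℝ → E → E}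
    (h : FluidPDE.IsMildNSSolutionBetween ν 0 u s (t + s)) :
    FluidPDE.IsMildNSSolutionFrom ν 0 (u s) (fun τ => u (τ + s)) t := by
  intro φ hφ hdiv
  have key := h φ hφ hdiv
  have e1 : (∫ τ in (0 : ℝ)..t, ∫ x, ⟪u (τ + s) x, convect (u (τ + s)) (heatTest ν φ (t - τ)) x⟫) =
      ∫ τ in s..(t + s), ∫ x, ⟪u τ x, convect (u τ) (heatTest ν φ (t + s - τ)) x⟫ := by
    have h1 := intervalIntegral.integral_comp_add_right (a := 0) (b := t)
      (fun τ => ∫ x, ⟪u τ x, convect (u τ) (heatTest ν φ (t + s - τ)) x⟫) s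
    simp only [zero_add, add_sub_add_right_eq_sub] at h1
    exact h1
  simp only [Pi.zero_apply, inner_zero_left, integral_zero, intervalIntegral.integral_zero,
    add_zero] at key ⊢
  rw [e1, key, add_sub_cancel_right]

variable {ι : Type*} [Fintype ι]

/-- **Besov continuity translates in time**: if `U ∈ C([0, T); Ḃ^s_{p,q})` then
`U(· + s₀) ∈ C([0, T - s₀); Ḃ^s_{p,q})` for `0 ≤ s₀` (composition with the translation, which maps
`[0, T - s₀)` into `[0, T)`). [folklore] -/
theorem ContinuousInHomBesovOn.translate {T s₀ : ℝ} {s : ℝ} {p q : ℝ≥0∞} [Fact (1 ≤ p)]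
    {U : ℝ → 𝓢'(EuclideanSpace ℝ ι, EuclideanSpace ℂ ι)}
    (h : ContinuousInHomBesovOn (Ico 0 T) s p q U) (hs₀ : 0 ≤ s₀) :
    ContinuousInHomBesovOn (Ico 0 (T - s₀)) s p q (fun t => U (t + s₀)) := by
  have hmaps : MapsTo (fun t : ℝ => t + s₀) (Ico 0 (T - s₀)) (Ico 0 T) := fun t ht =>
    ⟨by linarith [ht.1], by linarith [ht.2]⟩
  refine ⟨fun t ht => h.1 (t + s₀) (hmaps ht), fun t₀ ht₀ => ?_⟩
  have hg : Tendsto (fun t : ℝ => t + s₀) (𝓝[Ico 0 (T - s₀)] t₀) (𝓝[Ico 0 T] (t₀ + s₀)) :=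
    ((continuous_id.add continuous_const).continuousWithinAt).tendsto_nhdsWithin hmaps
  exact (h.2 (t₀ + s₀) (hmaps ht₀)).comp hg

/-- **Kato's weight bounds the slices away from `t = 0`**: if
`K = sup_{0 < τ' < T₁} √τ' ‖u(τ')‖_∞` then `‖u(τ)‖_∞ ≤ K / √s` for `0 < s ≤ τ < T₁`. [folklore] -/
theorem eLpNorm_le_katoWeight_div {u : ℝ → EuclideanSpace ℝ ι → EuclideanSpace ℝ ι}
    {T₁ s τ : ℝ} (hs : 0 < s) (hsτ : s ≤ τ) (hτ : τ < T₁) :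
    eLpNorm (u τ) ∞ volume ≤
      (⨆ τ' ∈ Ioo 0 T₁, ENNReal.ofReal (Real.sqrt τ') * eLpNorm (u τ') ∞ volume) /
        ENNReal.ofReal (Real.sqrt s) := by
  set K : ℝ≥0∞ := ⨆ τ' ∈ Ioo 0 T₁, ENNReal.ofReal (Real.sqrt τ') * eLpNorm (u τ') ∞ volume
    with hK
  have hτ0 : 0 < τ := hs.trans_le hsτ
  have hb : ENNReal.ofReal (Real.sqrt τ) * eLpNorm (u τ) ∞ volume ≤ K :=
    le_iSup₂ (f := fun τ' (_ : τ' ∈ Ioo (0 : ℝ) T₁) =>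
      ENNReal.ofReal (Real.sqrt τ') * eLpNorm (u τ') ∞ volume) τ ⟨hτ0, hτ⟩
  have hbt0 : ENNReal.ofReal (Real.sqrt τ) ≠ 0 :=
    (ENNReal.ofReal_pos.2 (Real.sqrt_pos.2 hτ0)).ne'
  have h1 : eLpNorm (u τ) ∞ volume ≤ K / ENNReal.ofReal (Real.sqrt τ) := by
    rw [ENNReal.le_div_iff_mul_le (Or.inl hbt0) (Or.inl ENNReal.ofReal_ne_top), mul_comm]
    exact hb
  exact h1.trans (ENNReal.div_le_div_left (ENNReal.ofReal_le_ofReal (Real.sqrt_le_sqrt hsτ)) K)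

/-- **The translate of a Kato-class field has uniformly bounded slices down to its initial
time**: if `u` is in Kato's class `K_∞` on `[0, T)` and `0 < s`, then for every `T₁ < T - s` the
slices `u(t + s)`, `0 ≤ t < T₁`, are essentially bounded by `K_{T₁+s} / √s < ∞`. [folklore] -/
theorem MemKatoClassOn.exists_eLpNorm_translate_le {T s : ℝ}
    {u : ℝ → EuclideanSpace ℝ ι → EuclideanSpace ℝ ι} (h : MemKatoClassOn T u) (hs : 0 < s) :
    ∀ T₁ ∈ Ioo 0 (T - s), ∃ C : ℝ≥0∞, C < ∞ ∧
      ∀ t ∈ Ico 0 T₁, eLpNorm (u (t + s)) ∞ volume ≤ C := by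
  intro T₁ hT₁
  set K : ℝ≥0∞ := ⨆ τ' ∈ Ioo 0 (T₁ + s), ENNReal.ofReal (Real.sqrt τ') * eLpNorm (u τ') ∞ volume
    with hK
  have hKtop : K < ∞ := h.1 (T₁ + s) (by linarith [hT₁.2])
  have ha0 : ENNReal.ofReal (Real.sqrt s) ≠ 0 :=
    (ENNReal.ofReal_pos.2 (Real.sqrt_pos.2 hs)).ne'
  refine ⟨K / ENNReal.ofReal (Real.sqrt s), ENNReal.div_lt_top hKtop.ne ha0, fun t ht => ?_⟩
  exact eLpNorm_le_katoWeight_div hs (by linarith [ht.1]) (by linarith [ht.2])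

/-- The same bound on the open time intervals `(0, T₁)` (the form consumed by
`knss_classical_of_bounded_isBesovMildSolutionOn`). [folklore] -/
theorem MemKatoClassOn.exists_eLpNorm_translate_le_Ioo {T s : ℝ}
    {u : ℝ → EuclideanSpace ℝ ι → EuclideanSpace ℝ ι} (h : MemKatoClassOn T u) (hs : 0 < s) :
    ∀ T₁ ∈ Ioo 0 (T - s), ∃ C : ℝ≥0∞, C < ∞ ∧
      ∀ t ∈ Ioo 0 T₁, eLpNorm (u (t + s)) ∞ volume ≤ C := by
  intro T₁ hT₁
  obtain ⟨C, hC, hb⟩ := h.exists_eLpNorm_translate_le hs T₁ hT₁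
  exact ⟨C, hC, fun t ht => hb t ⟨ht.1.le, ht.2⟩⟩

/-- **Kato's class translates in time**: if `u ∈ K_∞` on `[0, T)` and `0 < s < T`, then
`u(· + s) ∈ K_∞` on `[0, T - s)`; indeed `√t ‖u(t + s)‖_∞ ≤ √t · K/√s`, which is bounded on
bounded `t`-intervals and tends to `0` as `t → 0⁺`. [folklore] -/
theorem MemKatoClassOn.translate {T s : ℝ} {u : ℝ → EuclideanSpace ℝ ι → EuclideanSpace ℝ ι}
    (h : MemKatoClassOn T u) (hs : 0 < s) (hsT : s < T) :
    MemKatoClassOn (T - s) (fun t => u (t + s)) := by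
  refine ⟨fun t ht => ?_, ?_⟩
  · rcases le_or_gt t 0 with ht0 | ht0
    · rw [Ioo_eq_empty (not_lt.2 ht0)]
      simp
    · obtain ⟨C, hC, hb⟩ := h.exists_eLpNorm_translate_le hs t ⟨ht0, ht⟩
      have hle : ∀ τ ∈ Ioo 0 t, ENNReal.ofReal (Real.sqrt τ) * eLpNorm (u (τ + s)) ∞ volume ≤
          ENNReal.ofReal (Real.sqrt t) * C := fun τ hτ =>
        mul_le_mul' (ENNReal.ofReal_le_ofReal (Real.sqrt_le_sqrt hτ.2.le)) (hb τ ⟨hτ.1.le, hτ.2⟩)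
      exact lt_of_le_of_lt (iSup₂_le hle) (ENNReal.mul_lt_top ENNReal.ofReal_lt_top hC)
  · have hT2 : (T - s) / 2 ∈ Ioo 0 (T - s) := ⟨by linarith, by linarith⟩
    obtain ⟨C, hC, hb⟩ := h.exists_eLpNorm_translate_le hs ((T - s) / 2) hT2
    have hslice : ∀ t ∈ Ioo 0 ((T - s) / 2),
        ENNReal.ofReal (Real.sqrt t) * eLpNorm (u (t + s)) ∞ volume ≤
          ENNReal.ofReal (Real.sqrt t) * C := fun t ht =>
      mul_le_mul' le_rfl (hb t ⟨ht.1.le, ht.2⟩)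
    have hsqrt : Tendsto (fun t : ℝ => ENNReal.ofReal (Real.sqrt t)) (𝓝[>] 0) (𝓝 0) := by
      have hc : Continuous fun t : ℝ => ENNReal.ofReal (Real.sqrt t) :=
        ENNReal.continuous_ofReal.comp Real.continuous_sqrt
      have := (hc.tendsto 0).mono_left (nhdsWithin_le_nhds (s := Ioi (0 : ℝ)))
      rwa [Real.sqrt_zero, ENNReal.ofReal_zero] at this
    have hlim : Tendsto (fun t : ℝ => ENNReal.ofReal (Real.sqrt t) * C) (𝓝[>] 0) (𝓝 0) := by
      simpa only [zero_mul] using ENNReal.Tendsto.mul_const hsqrt (Or.inr hC.ne)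
    refine tendsto_of_tendsto_of_tendsto_of_le_of_le' tendsto_const_nhds hlim
      (Eventually.of_forall fun _ => zero_le) ?_
    filter_upwards [Ioo_mem_nhdsGT hT2.1] with t ht using hslice t ht

/-- **The Besov mild class is closed under time translation, given the restart identities.** Let
`(u, U)` be a Besov mild solution on `[0, T)` (class `(s, p, q)`, viscosity `ν`) and `0 < s₀ < T`,
and suppose the two-time duality identity `IsMildNSSolutionBetween ν 0 u s₀ t` holds for every
`t ∈ (s₀, T)`. Then `(u(· + s₀), U(· + s₀))` is a Besov mild solution on `[0, T - s₀)` from the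
datum `u(s₀)`: the mild clause is the translated two-time identity
(`IsMildNSSolutionBetween.isMildNSSolutionFrom_translate`, the case `t = 0` being the tautology
`IsMildNSSolutionBetween.refl`), the other clauses translate unconditionally. In the printed
classes (GKP 2016, `𝓛^{1:∞}_{p,q}(T)`; Lemarié-Rieusset 2016, bounded Oseen solutions) the
restart identities hold by the semigroup property of the absolutely convergent Duhamel formula;
here they are a hypothesis. [folklore] -/
theorem IsBesovMildSolutionOn.translate {s : ℝ} {p q : ℝ≥0∞} [Fact (1 ≤ p)] {T ν s₀ : ℝ}
    {u : ℝ → EuclideanSpace ℝ ι → EuclideanSpace ℝ ι}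
    {U : ℝ → 𝓢'(EuclideanSpace ℝ ι, EuclideanSpace ℂ ι)}
    (h : IsBesovMildSolutionOn s p q T ν u U) (hs₀ : 0 < s₀) (hs₀T : s₀ < T)
    (hR : ∀ ⦃t : ℝ⦄, s₀ < t → t < T → FluidPDE.IsMildNSSolutionBetween ν 0 u s₀ t) :
    IsBesovMildSolutionOn s p q (T - s₀) ν (fun t => u (t + s₀)) (fun t => U (t + s₀)) where
  mild := by
    refine ⟨fun t ht => h.mild.1 (t + s₀) ⟨by linarith [ht.1], by linarith [ht.2]⟩,
      fun t ht => ?_⟩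
    rw [zero_add]
    refine IsMildNSSolutionBetween.isMildNSSolutionFrom_translate ?_
    rcases ht.1.eq_or_lt with h0 | h0
    · rw [← h0, zero_add]
      exact FluidPDE.IsMildNSSolutionBetween.refl ν 0 u s₀
    · exact hR (by linarith) (by linarith [ht.2])
  aestronglyMeasurable := aestronglyMeasurable_uncurry_translate hs₀.le h.aestronglyMeasurable
  isDistributionOf t ht := h.isDistributionOf (t + s₀) ⟨by linarith [ht.1], by linarith [ht.2]⟩
  continuousInHomBesovOn := h.continuousInHomBesovOn.translate hs₀.le
  memKatoClassOn := h.memKatoClassOn.translate hs₀ hs₀T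

end Translate

/-! ## Gluing a family of classical solutions on the intervals `(s, T)` -/

section Glue

variable {E : Type*} [NormedAddCommGroup E] [InnerProductSpace ℝ E] [FiniteDimensional ℝ E]
variable {ν : ℝ}

/-- **Gluing classical solutions along the family of intervals `(s, T)`, `0 < s < T`.** Let
`(v s, π s)` be a classical solution on `(s, T)` for every `s ∈ (0, T)` (same viscosity and
force), and suppose the velocities agree wherever two of them are defined:
`v s t = v s' t` for `s, s' < t < T`. Then the velocity `t ↦ v (t/2) t` with the normalised
pressure `x ↦ π (t/2) t x - π (t/2) t 0` is a classical solution on `(0, T)`: on each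
`(s, T) × E` the glued velocity *is* `v s` and the glued pressure is the normalised `π s`
(`IsClassicalNSSolutionOn.pressure_sub_apply_zero_eq_of_eventuallyEq`: equal velocities near an
interior time force equal pressure gradients), so smoothness is local
(Mathlib `contDiffOn_of_locally_contDiffOn`) and the momentum equation at `t` is that of
`(v (t/2), π (t/2))` (interior time, two-sided derivatives; `gradient_sub_const`). Companion of
`IsClassicalNSSolutionOn.glue`. [folklore] -/
theorem IsClassicalNSSolutionOn.glue_Ioo_family {T : ℝ} {f : ℝ → E → E} {v : ℝ → ℝ → E → E}
    {π : ℝ → ℝ → E → ℝ} (h : ∀ s ∈ Ioo 0 T, IsClassicalNSSolutionOn (Ioo s T) ν f (v s) (π s))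
    (hagree : ∀ ⦃s s' t : ℝ⦄, 0 < s → s < t → 0 < s' → s' < t → t < T → v s t = v s' t) :
    IsClassicalNSSolutionOn (Ioo 0 T) ν f (fun t => v (t / 2) t)
      (fun t x => π (t / 2) t x - π (t / 2) t 0) := by
  -- on `(s, T)` the glued velocity is `v s` and the glued pressure is the normalised `π s`
  have hV : ∀ ⦃s t : ℝ⦄, 0 < s → s < t → t < T → v (t / 2) t = v s t := fun s t hs hst htT =>
    hagree (half_pos (hs.trans hst)) (half_lt_self (hs.trans hst)) hs hst htT
  have hPr : ∀ ⦃s t : ℝ⦄, 0 < s → s < t → t < T → ∀ x,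
      π (t / 2) t x - π (t / 2) t 0 = π s t x - π s t 0 := by
    intro s t hs hst htT x
    have ht0 : 0 < t := hs.trans hst
    have ht2 : 0 < t / 2 := half_pos ht0
    have ht2t : t / 2 < t := half_lt_self ht0
    refine (h (t / 2) ⟨ht2, ht2t.trans htT⟩).pressure_sub_apply_zero_eq_of_eventuallyEq
      (h s ⟨hs, hst.trans htT⟩) (Ioo_mem_nhds ht2t htT) (Ioo_mem_nhds hst htT) ?_ x
    filter_upwards [Ioo_mem_nhds (max_lt ht2t hst) htT] with τ hτ
    exact hagree ht2 ((le_max_left _ _).trans_lt hτ.1) hs ((le_max_right _ _).trans_lt hτ.1) hτ.2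
  -- the relatively open pieces `(s, T) × E` of `(0, T) × E`
  have hP : ∀ {s : ℝ}, 0 ≤ s →
      (Ioo 0 T ×ˢ (univ : Set E)) ∩ Ioi s ×ˢ univ = Ioo s T ×ˢ univ := by
    intro s hs
    rw [prod_inter_prod, inter_self]
    congr 1
    ext τ
    simp only [mem_inter_iff, mem_Ioo, mem_Ioi]
    exact ⟨fun h => ⟨h.2, h.1.2⟩, fun h => ⟨⟨hs.trans_lt h.1, h.2⟩, h.1⟩⟩
  refine ⟨?_, ?_, ?_, ?_⟩
  · -- smoothness of the glued velocity
    refine contDiffOn_of_locally_contDiffOn fun z hz => ?_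
    obtain ⟨t, x⟩ := z
    have ht : t ∈ Ioo 0 T := hz.1
    have hs : 0 < t / 2 := half_pos ht.1
    have hst : t / 2 < t := half_lt_self ht.1
    refine ⟨Ioi (t / 2) ×ˢ univ, isOpen_Ioi.prod isOpen_univ, ⟨hst, mem_univ _⟩, ?_⟩
    rw [hP hs.le]
    refine (h (t / 2) ⟨hs, hst.trans ht.2⟩).smooth_velocity.congr fun z hz => ?_
    obtain ⟨τ, y⟩ := z
    have hτ : τ ∈ Ioo (t / 2) T := hz.1
    simp only [uncurry_apply_pair]
    rw [hV hs hτ.1 hτ.2]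
  · -- smoothness of the glued (normalised) pressure
    refine contDiffOn_of_locally_contDiffOn fun z hz => ?_
    obtain ⟨t, x⟩ := z
    have ht : t ∈ Ioo 0 T := hz.1
    have hs : 0 < t / 2 := half_pos ht.1
    have hst : t / 2 < t := half_lt_self ht.1
    refine ⟨Ioi (t / 2) ×ˢ univ, isOpen_Ioi.prod isOpen_univ, ⟨hst, mem_univ _⟩, ?_⟩
    rw [hP hs.le]
    refine (h (t / 2) ⟨hs, hst.trans ht.2⟩).smooth_pressure.sub_apply_zero.congr fun z hz => ?_
    obtain ⟨τ, y⟩ := z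
    have hτ : τ ∈ Ioo (t / 2) T := hz.1
    simp only [uncurry_apply_pair]
    exact hPr hs hτ.1 hτ.2 y
  · -- the momentum equation at `t`: that of `(v (t/2), π (t/2))`
    intro t ht x
    have hs : 0 < t / 2 := half_pos ht.1
    have hst : t / 2 < t := half_lt_self ht.1
    have hsol := h (t / 2) ⟨hs, hst.trans ht.2⟩
    have hev : (fun τ => v (τ / 2) τ x) =ᶠ[𝓝 t] fun τ => v (t / 2) τ x := by
      filter_upwards [Ioo_mem_nhds hst ht.2] with τ hτ
      rw [hV hs hτ.1 hτ.2]
    have hD : timeDerivWithin (Ioo 0 T) (fun τ => v (τ / 2) τ) t x =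
        timeDerivWithin (Ioo (t / 2) T) (v (t / 2)) t x := by
      simp only [timeDerivWithin_apply]
      rw [derivWithin_of_mem_nhds (Ioo_mem_nhds ht.1 ht.2),
        derivWithin_of_mem_nhds (Ioo_mem_nhds hst ht.2)]
      exact hev.deriv_eq
    rw [hD]
    have hg : gradient (fun y => π (t / 2) t y - π (t / 2) t 0) x = gradient (π (t / 2) t) x :=
      gradient_sub_const _ _ _
    simp only [hg]
    exact hsol.momentum t ⟨hst, ht.2⟩ x
  · -- incompressibility
    intro t ht
    exact (h (t / 2) ⟨half_pos ht.1, (half_lt_self ht.1).trans ht.2⟩).divFree t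
      ⟨half_lt_self ht.1, ht.2⟩

end Glue

/-! ## The reduction -/

section Assembly

/-- **A Besov mild solution with the restart property is classical at positive times, given the
KNSS smoothing of bounded solutions** (GKP 2016, (1.6), for the tree's class; KNSS 2009, §4 for
the bounded step). Let `ν > 0`, `3 < p < ∞`, `1 ≤ q < ∞`, let `(u, U)` be a Besov mild solution
on `[0, T)` in the class `(-1 + 3/p, p, q)`, and suppose the two-time duality identity
`IsMildNSSolutionBetween ν 0 u s t` holds for all `0 < s < t < T`. Then, granted
`knss_classical_of_bounded_isBesovMildSolutionOn`, there is a classical solution `(v, π)` of the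
unforced system on `(0, T)` with `u(t) = v(t)` a.e. for every `t ∈ (0, T)`. Proof: each
translate `u(· + s)`, `0 < s < T`, is a Besov mild solution on `[0, T - s)` with slices bounded by
`K/√s` (`IsBesovMildSolutionOn.translate`, `MemKatoClassOn.exists_eLpNorm_translate_le_Ioo`), so
by the KNSS fact it agrees a.e. with a classical solution on `(0, T - s)`; translating back gives
classical solutions on `(s, T)` a.e. equal to `u`, whose continuous velocities therefore agree on
common times (`eq_of_ae_eq_of_continuous`), and `IsClassicalNSSolutionOn.glue_Ioo_family` glues
them. [cite: GKP2016, (1.6) (p. 4)] -/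
theorem IsBesovMildSolutionOn.exists_classical_of_restart
    (hK : knss_classical_of_bounded_isBesovMildSolutionOn) {ν T : ℝ} (hν : 0 < ν)
    {p q : ℝ≥0∞} [Fact (1 ≤ p)] (hp₃ : 3 < p) (hp : p < ∞) (hq₁ : 1 ≤ q) (hq : q < ∞)
    {u : ℝ → EuclideanSpace ℝ (Fin 3) → EuclideanSpace ℝ (Fin 3)}
    {U : ℝ → 𝓢'(EuclideanSpace ℝ (Fin 3), EuclideanSpace ℂ (Fin 3))}
    (hB : IsBesovMildSolutionOn (-1 + 3 / p.toReal) p q T ν u U)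
    (hR : ∀ ⦃s t : ℝ⦄, 0 < s → s < t → t < T → FluidPDE.IsMildNSSolutionBetween ν 0 u s t) :
    ∃ (v : ℝ → EuclideanSpace ℝ (Fin 3) → EuclideanSpace ℝ (Fin 3))
      (π : ℝ → EuclideanSpace ℝ (Fin 3) → ℝ),
      FluidPDE.IsClassicalNSSolutionOn (Ioo 0 T) ν 0 v π ∧ ∀ t ∈ Ioo 0 T, u t =ᵐ[volume] v t := by
  -- for each `s ∈ (0, T)`: a classical solution on `(s, T)` a.e. equal to `u`
  have hcl : ∀ s ∈ Ioo 0 T, ∃ (w : ℝ → EuclideanSpace ℝ (Fin 3) → EuclideanSpace ℝ (Fin 3))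
      (π : ℝ → EuclideanSpace ℝ (Fin 3) → ℝ),
      FluidPDE.IsClassicalNSSolutionOn (Ioo s T) ν 0 w π ∧ ∀ t ∈ Ioo s T, u t =ᵐ[volume] w t := by
    intro s hs
    have hBs : IsBesovMildSolutionOn (-1 + 3 / p.toReal) p q (T - s) ν (fun t => u (t + s))
        (fun t => U (t + s)) :=
      hB.translate hs.1 hs.2 fun t hst htT => hR hs.1 hst htT
    obtain ⟨w, π, hw, hwu⟩ := hK hν (sub_pos.2 hs.2) hp₃ hp hq₁ hq hBs
      (hB.memKatoClassOn.exists_eLpNorm_translate_le_Ioo hs.1)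
    refine ⟨fun t => w (t + -s), fun t => π (t + -s), ?_, fun t ht => ?_⟩
    · have h1 := hw.comp_add_right (-s)
      have hf :
          (fun t => (0 : ℝ → EuclideanSpace ℝ (Fin 3) → EuclideanSpace ℝ (Fin 3)) (t + -s)) =
            0 := by
        funext t
        rfl
      rw [hf] at h1
      exact h1.mono (fun t ht => ⟨by linarith [ht.1], by linarith [ht.2]⟩) isOpen_Ioo.uniqueDiffOn
    · have h2 := hwu (t + -s) ⟨by linarith [ht.1], by linarith [ht.2]⟩
      rwa [neg_add_cancel_right] at h2
  choose! w π hw hwu using hcl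
  -- continuous velocities a.e. equal to `u t` agree
  have hagree : ∀ ⦃s s' t : ℝ⦄, 0 < s → s < t → 0 < s' → s' < t → t < T → w s t = w s' t := by
    intro s s' t hs hst hs' hs't htT
    exact eq_of_ae_eq_of_continuous
      ((hw s ⟨hs, hst.trans htT⟩).contDiff_velocity ⟨hst, htT⟩).continuous
      ((hw s' ⟨hs', hs't.trans htT⟩).contDiff_velocity ⟨hs't, htT⟩).continuous
      ((hwu s ⟨hs, hst.trans htT⟩ t ⟨hst, htT⟩).symm.trans
        (hwu s' ⟨hs', hs't.trans htT⟩ t ⟨hs't, htT⟩))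
  refine ⟨fun t => w (t / 2) t, fun t x => π (t / 2) t x - π (t / 2) t 0,
    IsClassicalNSSolutionOn.glue_Ioo_family (fun s hs => hw s hs) hagree, fun t ht => ?_⟩
  exact hwu (t / 2) ⟨half_pos ht.1, (half_lt_self ht.1).trans ht.2⟩ t ⟨half_lt_self ht.1, ht.2⟩

-- `linter.deprecated` is switched off for the next two declarations only: their conclusion is the
-- tree-class rendering `gkp_smooth_of_isBesovMildSolutionOn` of GKP (1.6) (`NSCriticalClosureBesov.lean`),
-- deprecated as mis-stated by the verdict clean-up of 2026-08-16; these two theorems are precisely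
-- the machine-checked dissection that verdict cites (deprecated fact = bounded theorem + restart).
set_option linter.deprecated false in
/-- **GKP (1.6) for the tree's class from the KNSS bounded smoothing fact and the restart
property.** `gkp_smooth_of_isBesovMildSolutionOn` (deprecated, mis-stated over the tree's class —
`NSCriticalClosureBesov.lean` §Verdict clean-up; this theorem is the dissection named there)
follows from `knss_classical_of_bounded_isBesovMildSolutionOn` (KNSS 2009, §4; itself reduced to
(L) `knss2009_local_smoothing ℝ³` in `NSBoundedMildOseenAssembly.lean`) **and** the restart of
the duality identity at positive times for the class `IsBesovMildSolutionOn` in the GKP range — the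
hypothesis `hR`, which is *not* a published result about this class and is not asserted here
(see the module docstring: in GKP's class `𝓛^{1:∞}_{p,q}(T)` it is the semigroup property of the
absolutely convergent Duhamel formula). [cite: GKP2016, (1.6) (p. 4)] -/
theorem gkp_smooth_of_isBesovMildSolutionOn_of_knss_of_restart
    (hK : knss_classical_of_bounded_isBesovMildSolutionOn)
    (hR : ∀ ⦃ν T : ℝ⦄, 0 < ν → 0 < T → ∀ ⦃p q : ℝ≥0∞⦄ [Fact (1 ≤ p)], 3 < p → p < ∞ → 1 ≤ q →
      q < ∞ → ∀ ⦃u : ℝ → EuclideanSpace ℝ (Fin 3) → EuclideanSpace ℝ (Fin 3)⦄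
        ⦃U : ℝ → 𝓢'(EuclideanSpace ℝ (Fin 3), EuclideanSpace ℂ (Fin 3))⦄,
        IsBesovMildSolutionOn (-1 + 3 / p.toReal) p q T ν u U →
          ∀ ⦃s t : ℝ⦄, 0 < s → s < t → t < T → FluidPDE.IsMildNSSolutionBetween ν 0 u s t) :
    gkp_smooth_of_isBesovMildSolutionOn :=
  fun _ν _T hν hT _p _q _ hp₃ hp hq₁ hq _u _U hB =>
    hB.exists_classical_of_restart hK hν hp₃ hp hq₁ hq (hR hν hT hp₃ hp hq₁ hq hB)

-- (second of the two declarations announced above)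
set_option linter.deprecated false in
/-- **GKP (1.6) for the tree's class from the KNSS local theory (L) and the restart property.**
With (A), (R), (C) of `NSBoundedMildOseen.lean` discharged
(`knss_classical_of_bounded_isBesovMildSolutionOn_of_local`), the named fact
`gkp_smooth_of_isBesovMildSolutionOn` follows from the single named fact
(L) `knss2009_local_smoothing ℝ³` (KNSS 2009, Prop. 4.1, short-time form) and the restart
hypothesis `hR` of `gkp_smooth_of_isBesovMildSolutionOn_of_knss_of_restart` (the conclusion is
the deprecated tree-class rendering of GKP (1.6); see the comment above that theorem). [cite: KochNadirashviliSereginSverak2009, §4 with Prop. 4.1 (arXiv:0709.3599 p. 8)] -/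
theorem gkp_smooth_of_isBesovMildSolutionOn_of_local_of_restart
    (hL : knss2009_local_smoothing (EuclideanSpace ℝ (Fin 3)))
    (hR : ∀ ⦃ν T : ℝ⦄, 0 < ν → 0 < T → ∀ ⦃p q : ℝ≥0∞⦄ [Fact (1 ≤ p)], 3 < p → p < ∞ → 1 ≤ q →
      q < ∞ → ∀ ⦃u : ℝ → EuclideanSpace ℝ (Fin 3) → EuclideanSpace ℝ (Fin 3)⦄
        ⦃U : ℝ → 𝓢'(EuclideanSpace ℝ (Fin 3), EuclideanSpace ℂ (Fin 3))⦄,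
        IsBesovMildSolutionOn (-1 + 3 / p.toReal) p q T ν u U →
          ∀ ⦃s t : ℝ⦄, 0 < s → s < t → t < T → FluidPDE.IsMildNSSolutionBetween ν 0 u s t) :
    gkp_smooth_of_isBesovMildSolutionOn :=
  gkp_smooth_of_isBesovMildSolutionOn_of_knss_of_restart
    (knss_classical_of_bounded_isBesovMildSolutionOn_of_local hL) hR

end Assembly

end Literature.Analysis.FluidPDE

end
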